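import Summits.HodgeConjecture.CorCM.Census.QuarticInversionPotential

/-!
# The quartic inversion twists, VI: the reducing face through every non-residual label, and the descent

COR-CM (cell `pub-hodgecm2`, stage 2 of the Hodge ladder), count-neutral KERNEL COMBINATORICS by the binder seat b23 (gen 44; claim
QUARTIC-INVERSION, HOME/INBOX.md l.12829).  Part VI of the lane `Census/QuarticInversion*`, on top of parts I–V (`…Potential`: `pot₄`, `half`) and the dicyclic lane's part III
(`Census/DicyclicTwistDescent.lean`: `exists_two_reducing`, `exists_one_reducing`) and seat b09's slice (`clsTy`, `wt`), all BY
NAME.  One bookkeeping definition with body (`corner`) + theorems; no `Prop`-valued definition, no `decide` table, no certificate, no named fact, no geometry, no `sorry`.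
`Interfaces.lean` (C1), every E term, B01, `Transposition/*`, `PortJoin/*` untouched.
HONEST FRAMING: `HC_CM` is NOT proved, here or anywhere in the tree; nothing here is a period, a count of record or a headline.

CONTENT.
* §2 **A generic descent** (any finite label type with a potential): if a submodule `S` contains, through every label of potential `K ≥ 2`, a vector
  equal to `1` there and otherwise supported in potential `< K`, then every vector is congruent modulo `S` to one supported in potential `≤ 1`
  (`descent_of_cover`).
* §3 **The reducing face through every non-residual label** (`exists_reducing`): if some coordinate has class `≥ 2`, b09's square through two defects /
  two zeros in that coordinate (the other three passive); otherwise two coordinates are atoms and the mixed face at their reducing places does it; in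
  either case the three other corners (`corner Θ p q c`, `c ∈ Fin 3`) have smaller potential AND every coordinate of every corner stays in its half
  (`half` preserved) — the latter is what makes the functionals of part VI vanish on these faces (`|B|` odd).  With part IV: reducing pairs move with
  the labels (`reducing_twH₄`, `reducing_twY`, `reducing_twT`), so ONE reducing face per non-residual block covers every non-residual label (the count).
All [folklore].

## References
* [Pohlmann1968] H. Pohlmann, Algebraic cycles on abelian varieties of complex multiplication type, Ann. of Math. 88 (1968), Thm 1.
-/

namespace Summit.HodgeConjecture.CorCM.Census.QuarticInversion

open Finset
open Summit.HodgeConjecture.CorCM.Census.OddSliceFacesModel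
open Summit.HodgeConjecture.CorCM.Census.OddSliceFacesSquares (clsTy clsTy_tw wt_corner_flip)
open Summit.HodgeConjecture.CorCM.Census.DicyclicTwist (Ty₂ rev twH exists_two_reducing exists_one_reducing clsTy_rev)
open Summit.HodgeConjecture.CorCM.Census.EvenSliceFacesDescent (clsTy_add_one)

noncomputable section

/-! ## §2 A generic descent -/

section Descent

variable {L : Type} [Fintype L] [DecidableEq L] (pot : L → ℕ)

/-- **Clearing step** (generic): if `S` contains through every label of potential `K ≥ 2` a vector which is `1` there and otherwise supported in
potential `< K`, a vector supported in potential `≤ K` is congruent modulo `S` to one supported in potential `≤ K − 1`. [folklore] -/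
theorem clear_step_of_cover (S : Submodule ℤ (L → ℤ)) {K : ℕ}
    (hcover : ∀ Ψ : L, pot Ψ = K → ∃ v ∈ S, v Ψ = 1 ∧ ∀ χ, χ ≠ Ψ → v χ ≠ 0 → pot χ < K)
    (m : L → ℤ) (hm : ∀ χ, m χ ≠ 0 → pot χ ≤ K) :
    ∃ m' : L → ℤ, (∀ χ, m' χ ≠ 0 → pot χ ≤ K - 1) ∧ m - m' ∈ S := by
  choose! F hFmem hFone hFlt using hcover
  set T : Finset L := univ.filter fun Ψ => pot Ψ = K with hT
  set q : L → ℤ := ∑ Ψ ∈ T, m Ψ • F Ψ with hq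
  have hqmem : q ∈ S := Submodule.sum_mem _ fun Ψ hΨ => Submodule.smul_mem _ _ (hFmem Ψ (Finset.mem_filter.mp hΨ).2)
  have hqval : ∀ χ : L, K ≤ pot χ → q χ = if pot χ = K then m χ else 0 := by
    intro χ hχ
    rw [hq, Finset.sum_apply]
    have hterm : ∀ Ψ ∈ T, (m Ψ • F Ψ) χ = if χ = Ψ then m Ψ else 0 := by
      intro Ψ hΨ
      have hΨK : pot Ψ = K := (Finset.mem_filter.mp hΨ).2
      rw [Pi.smul_apply, smul_eq_mul]
      by_cases e : χ = Ψ
      · rw [if_pos e, e, hFone Ψ hΨK, mul_one]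
      · rw [if_neg e]
        by_cases hz : F Ψ χ = 0
        · rw [hz, mul_zero]
        · exact absurd (hFlt Ψ hΨK χ e hz) (by omega)
    rw [Finset.sum_congr rfl hterm, Finset.sum_ite_eq]
    have hTmem : χ ∈ T ↔ pot χ = K := by rw [hT]; simp
    by_cases hχK : pot χ = K
    · rw [if_pos (hTmem.mpr hχK), if_pos hχK]
    · rw [if_neg (fun h' => hχK (hTmem.mp h')), if_neg hχK]
  refine ⟨m - q, ?_, ?_⟩
  · intro χ hχ
    by_contra hKχ
    have hKle : K ≤ pot χ := by omega
    apply hχ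
    rw [Pi.sub_apply, hqval χ hKle]
    by_cases hχK : pot χ = K
    · rw [if_pos hχK, sub_self]
    · rw [if_neg hχK, sub_zero]
      by_contra hmχ
      exact hχK (le_antisymm (hm χ hmχ) hKle)
  · have : m - (m - q) = q := by abel
    rw [this]; exact hqmem

/-- **Descent** (generic): if `S` contains through every label of potential `≥ 2` a vector which is `1` there and otherwise supported in smaller
potential, every vector supported in potential `≤ K` is congruent modulo `S` to one supported in potential `≤ 1`. [folklore] -/
theorem descent_of_cover (S : Submodule ℤ (L → ℤ))
    (hcover : ∀ Ψ : L, 2 ≤ pot Ψ → ∃ v ∈ S, v Ψ = 1 ∧ ∀ χ, χ ≠ Ψ → v χ ≠ 0 → pot χ < pot Ψ)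
    (K : ℕ) (m : L → ℤ) (hm : ∀ χ, m χ ≠ 0 → pot χ ≤ K) :
    ∃ r : L → ℤ, (∀ χ, r χ ≠ 0 → pot χ ≤ 1) ∧ m - r ∈ S := by
  induction K generalizing m with
  | zero => exact ⟨m, fun χ h => (hm χ h).trans (Nat.zero_le 1), by rw [sub_self]; exact Submodule.zero_mem _⟩
  | succ K ih =>
    by_cases hK1 : K + 1 ≤ 1
    · exact ⟨m, fun χ h => (hm χ h).trans hK1, by rw [sub_self]; exact Submodule.zero_mem _⟩
    · obtain ⟨m', hm', hdiff⟩ := clear_step_of_cover pot S (K := K + 1)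
        (fun Ψ hΨ => by
          obtain ⟨v, hv, h1, h2⟩ := hcover Ψ (by omega)
          exact ⟨v, hv, h1, fun χ hχ hz => by rw [← hΨ]; exact h2 χ hχ hz⟩) m hm
      obtain ⟨r, hr, hdiff'⟩ := ih m' (fun χ h => by have := hm' χ h; omega)
      refine ⟨r, hr, ?_⟩
      have : m - r = (m - m') + (m' - r) := by abel
      rw [this]
      exact Submodule.add_mem _ hdiff hdiff'

omit [Fintype L] in
/-- A sum of four unit vectors whose last three labels have smaller potential than the first is `1` at the first label and otherwise
supported in smaller potential. [folklore] -/
theorem one_and_lower_of_corners {Ψ c₂ c₃ c₄ : L} (h₂ : pot c₂ < pot Ψ) (h₃ : pot c₃ < pot Ψ) (h₄ : pot c₄ < pot Ψ) :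
    (Pi.single Ψ 1 + Pi.single c₂ 1 + Pi.single c₃ 1 + Pi.single c₄ 1 : L → ℤ) Ψ = 1 ∧
      ∀ χ, χ ≠ Ψ → (Pi.single Ψ 1 + Pi.single c₂ 1 + Pi.single c₃ 1 + Pi.single c₄ 1 : L → ℤ) χ ≠ 0 → pot χ < pot Ψ := by
  have n₂ : Ψ ≠ c₂ := fun h => by rw [h] at h₂; exact lt_irrefl _ h₂
  have n₃ : Ψ ≠ c₃ := fun h => by rw [h] at h₃; exact lt_irrefl _ h₃
  have n₄ : Ψ ≠ c₄ := fun h => by rw [h] at h₄; exact lt_irrefl _ h₄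
  refine ⟨by simp [n₂, n₃, n₄], fun χ hχ hv => ?_⟩
  simp only [Pi.add_apply, Pi.single_apply, if_neg hχ, zero_add] at hv
  by_cases e₂ : χ = c₂
  · rw [e₂]; exact h₂
  by_cases e₃ : χ = c₃
  · rw [e₃]; exact h₃
  by_cases e₄ : χ = c₄
  · rw [e₄]; exact h₄
  simp [e₂, e₃, e₄] at hv

end Descent

/-! ## §3 The reducing face through every non-residual label -/

section Reducing

variable (A : Type) [AddCommGroup A] [Fintype A] [DecidableEq A]

/-- **The three flipped corners** of the face through `Θ` at the places `p, q`: `Θ^{(p)}, Θ^{(q)}, Θ^{(pq)}`. [folklore] -/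
def corner (Θ : Ty₄ A) (p q : Pl A) : Fin 3 → Ty₄ A := ![flipAt A p Θ, flipAt A q Θ, flipAt A p (flipAt A q Θ)]

omit [AddCommGroup A] [Fintype A] in
/-- The three corners, explicitly. [folklore] -/
@[simp] theorem corner_zero (Θ : Ty₄ A) (p q : Pl A) : corner A Θ p q 0 = flipAt A p Θ := rfl
omit [AddCommGroup A] [Fintype A] in
/-- The three corners, explicitly. [folklore] -/
@[simp] theorem corner_one (Θ : Ty₄ A) (p q : Pl A) : corner A Θ p q 1 = flipAt A q Θ := rfl
omit [AddCommGroup A] [Fintype A] in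
/-- The three corners, explicitly. [folklore] -/
@[simp] theorem corner_two (Θ : Ty₄ A) (p q : Pl A) : corner A Θ p q 2 = flipAt A p (flipAt A q Θ) := rfl

omit [AddCommGroup A] [Fintype A] in
/-- A flip changes its own coordinate by `δ`. [folklore] -/
theorem coord_flipAt_self (k : Fin 4) (i : A) (Θ : Ty₄ A) : coord A k (flipAt A (k, i) Θ) = coord A k Θ + δ A i := by
  rw [coord_flipAt, bump, if_pos rfl]

omit [AddCommGroup A] [Fintype A] in
/-- A flip leaves the other coordinates alone. [folklore] -/
theorem coord_flipAt_of_ne {n k : Fin 4} (h : n ≠ k) (i : A) (Θ : Ty₄ A) : coord A n (flipAt A (k, i) Θ) = coord A n Θ := by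
  rw [coord_flipAt, bump, if_neg h, add_zero]

omit [AddCommGroup A] in
/-- Potential drop of a single flip in terms of the class drop. [folklore] -/
theorem pot₄_flipAt_lt_iff (p : Pl A) (Θ : Ty₄ A) :
    pot₄ A (flipAt A p Θ) < pot₄ A Θ ↔ clsTy A (coord A p.1 Θ + δ A p.2) < clsTy A (coord A p.1 Θ) := by
  have h := pot₄_addAt A p.1 (δ A p.2) Θ
  unfold flipAt
  omega

omit [AddCommGroup A] in
/-- **Case 1: a coordinate of class `≥ 2`** — b09's square through two defects / two zeros in that coordinate lowers the potential at the three
other corners and keeps every coordinate in its half. [folklore] -/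
theorem exists_reducing_of_two_le {Θ : Ty₄ A} {k : Fin 4} (hk : 2 ≤ clsTy A (coord A k Θ)) :
    ∃ p q : Pl A, p ≠ q ∧ ∀ c, pot₄ A (corner A Θ p q c) < pot₄ A Θ ∧ ∀ n, half A (coord A n (corner A Θ p q c)) = half A (coord A n Θ) := by
  obtain ⟨⟨i, j⟩, hij, r1, r2, r3, l1, l2, l3⟩ := exists_two_reducing A hk
  dsimp only at hij r1 r2 r3 l1 l2 l3
  have hpq : pot₄ A (flipAt A (k, i) (flipAt A (k, j) Θ)) < pot₄ A Θ := by
    have h1 := pot₄_addAt A k (δ A i) (flipAt A (k, j) Θ)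
    have h2 := pot₄_addAt A k (δ A j) Θ
    rw [coord_flipAt_self, add_right_comm (coord A k Θ) (δ A j) (δ A i)] at h1
    show pot₄ A (addAt A k (δ A i) (flipAt A (k, j) Θ)) < pot₄ A Θ
    simp only [flipAt] at h1 ⊢
    omega
  refine ⟨(k, i), (k, j), fun h => hij (Prod.mk.inj h).2, fun c => ?_⟩
  fin_cases c
  all_goals simp only [Fin.zero_eta, Fin.mk_one, Fin.reduceFinMk, Fin.isValue]
  · refine ⟨(pot₄_flipAt_lt_iff A (k, i) Θ).mpr r1, fun n => ?_⟩
    by_cases hnk : n = k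
    · subst hnk; rw [corner_zero, coord_flipAt_self, half_eq_half_iff]; exact l1
    · rw [corner_zero, coord_flipAt_of_ne A hnk]
  · refine ⟨(pot₄_flipAt_lt_iff A (k, j) Θ).mpr r2, fun n => ?_⟩
    by_cases hnk : n = k
    · subst hnk; rw [corner_one, coord_flipAt_self, half_eq_half_iff]; exact l2
    · rw [corner_one, coord_flipAt_of_ne A hnk]
  · refine ⟨hpq, fun n => ?_⟩
    by_cases hnk : n = k
    · subst hnk
      rw [corner_two, coord_flipAt_self, coord_flipAt_self, add_right_comm, half_eq_half_iff]; exact l3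
    · rw [corner_two, coord_flipAt_of_ne A hnk, coord_flipAt_of_ne A hnk]

omit [AddCommGroup A] [DecidableEq A] in
/-- Classes at most one and potential at least two force two distinct atom coordinates. [folklore] -/
theorem exists_two_atoms {Θ : Ty₄ A} (h2 : 2 ≤ pot₄ A Θ) (hle : ∀ k, clsTy A (coord A k Θ) ≤ 1) :
    ∃ k l : Fin 4, k ≠ l ∧ clsTy A (coord A k Θ) = 1 ∧ clsTy A (coord A l Θ) = 1 := by
  have h0 := hle 0; have h1 := hle 1; have h2' := hle 2; have h3 := hle 3
  rw [pot₄_eq_sum, Fin.sum_univ_four] at h2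
  by_cases a0 : clsTy A (coord A 0 Θ) = 1
  · by_cases a1 : clsTy A (coord A 1 Θ) = 1
    · exact ⟨0, 1, by decide, a0, a1⟩
    by_cases a2 : clsTy A (coord A 2 Θ) = 1
    · exact ⟨0, 2, by decide, a0, a2⟩
    · exact ⟨0, 3, by decide, a0, by omega⟩
  · by_cases a1 : clsTy A (coord A 1 Θ) = 1
    · by_cases a2 : clsTy A (coord A 2 Θ) = 1
      · exact ⟨1, 2, by decide, a1, a2⟩
      · exact ⟨1, 3, by decide, a1, by omega⟩
    · exact ⟨2, 3, by decide, by omega, by omega⟩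

omit [AddCommGroup A] in
/-- **Case 2: two atom coordinates** — the mixed face at their reducing places. [folklore] -/
theorem exists_reducing_of_atoms {Θ : Ty₄ A} {k l : Fin 4} (hkl : k ≠ l) (hk : clsTy A (coord A k Θ) = 1)
    (hl : clsTy A (coord A l Θ) = 1) :
    ∃ p q : Pl A, p ≠ q ∧ ∀ c, pot₄ A (corner A Θ p q c) < pot₄ A Θ ∧ ∀ n, half A (coord A n (corner A Θ p q c)) = half A (coord A n Θ) := by
  obtain ⟨i, hi, li⟩ := exists_one_reducing A hk
  obtain ⟨j, hj, lj⟩ := exists_one_reducing A hl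
  have hq : pot₄ A (flipAt A (l, j) Θ) < pot₄ A Θ := by rw [pot₄_flipAt_lt_iff]; simp only; omega
  have hpq : pot₄ A (flipAt A (k, i) (flipAt A (l, j) Θ)) < pot₄ A Θ := by
    have h1 : pot₄ A (flipAt A (k, i) (flipAt A (l, j) Θ)) < pot₄ A (flipAt A (l, j) Θ) := by
      rw [pot₄_flipAt_lt_iff]
      simp only [coord_flipAt_of_ne A hkl]
      omega
    exact h1.trans hq
  refine ⟨(k, i), (l, j), fun h => hkl (Prod.mk.inj h).1, fun c => ?_⟩
  fin_cases c
  all_goals simp only [Fin.zero_eta, Fin.mk_one, Fin.reduceFinMk, Fin.isValue]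
  · refine ⟨by rw [corner_zero, pot₄_flipAt_lt_iff]; simp only; omega, fun n => ?_⟩
    by_cases hnk : n = k
    · subst hnk; rw [corner_zero, coord_flipAt_self, half_eq_half_iff]; exact li
    · rw [corner_zero, coord_flipAt_of_ne A hnk]
  · refine ⟨hq, fun n => ?_⟩
    by_cases hnl : n = l
    · subst hnl; rw [corner_one, coord_flipAt_self, half_eq_half_iff]; exact lj
    · rw [corner_one, coord_flipAt_of_ne A hnl]
  · refine ⟨hpq, fun n => ?_⟩
    rw [corner_two]
    by_cases hnk : n = k
    · subst hnk; rw [coord_flipAt_self, coord_flipAt_of_ne A hkl, half_eq_half_iff]; exact li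
    · rw [coord_flipAt_of_ne A hnk]
      by_cases hnl : n = l
      · subst hnl; rw [coord_flipAt_self, half_eq_half_iff]; exact lj
      · rw [coord_flipAt_of_ne A hnl]

omit [AddCommGroup A] in
/-- **Through every non-residual label there is a reducing pair of places**: two distinct places whose three flipped corners have smaller potential,
every coordinate staying in its half. [folklore] -/
theorem exists_reducing {Θ : Ty₄ A} (h2 : 2 ≤ pot₄ A Θ) :
    ∃ p q : Pl A, p ≠ q ∧ ∀ c, pot₄ A (corner A Θ p q c) < pot₄ A Θ ∧ ∀ n, half A (coord A n (corner A Θ p q c)) = half A (coord A n Θ) := by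
  by_cases hex : ∃ k, 2 ≤ clsTy A (coord A k Θ)
  · obtain ⟨k, hk⟩ := hex
    exact exists_reducing_of_two_le A hk
  · have hle : ∀ k, clsTy A (coord A k Θ) ≤ 1 := fun k => by
      by_contra h; exact hex ⟨k, by omega⟩
    obtain ⟨k, l, hkl, hk, hl⟩ := exists_two_atoms A h2 hle
    exact exists_reducing_of_atoms A hkl hk hl

/-- **The face at a reducing pair is `1` at its label and otherwise supported in smaller potential.** [folklore] -/
theorem faceVec₄_reducing {Θ : Ty₄ A} {p q : Pl A} (h : ∀ c, pot₄ A (corner A Θ p q c) < pot₄ A Θ) :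
    faceVec₄ A Θ p q Θ = 1 ∧ ∀ χ, χ ≠ Θ → faceVec₄ A Θ p q χ ≠ 0 → pot₄ A χ < pot₄ A Θ :=
  one_and_lower_of_corners (pot₄ A) (Ψ := Θ) (c₂ := conj₄ A (flipAt A p Θ)) (c₃ := conj₄ A (flipAt A q Θ))
    (c₄ := flipAt A p (flipAt A q Θ)) (by rw [pot₄_conj₄]; exact h 0)
    (by rw [pot₄_conj₄]; exact h 1) (h 2)

/-! ### Reducing pairs move with the labels -/

omit [Fintype A] in
/-- The corners of a moved face are the moved corners (`H₀`). [folklore] -/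
theorem corner_twH₄ (g : ZMod 2 × A) (Θ : Ty₄ A) (p q : Pl A) (c : Fin 3) :
    corner A (twH₄ A g Θ) (plH A g p) (plH A g q) c = twH₄ A g (corner A Θ p q c) := by
  fin_cases c <;> simp [corner, twH₄_flipAt]

omit [Fintype A] in
/-- The corners of a moved face are the moved corners (`y`). [folklore] -/
theorem corner_twY (ζ : ZMod 2) (Θ : Ty₄ A) (p q : Pl A) (c : Fin 3) :
    corner A (twY A ζ Θ) (plY A p) (plY A q) c = twY A ζ (corner A Θ p q c) := by
  fin_cases c <;> simp [corner, twY_flipAt]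

omit [AddCommGroup A] [Fintype A] in
/-- The corners of a moved face are the moved corners (`t`). [folklore] -/
theorem corner_twT (Θ : Ty₄ A) (p q : Pl A) (c : Fin 3) :
    corner A (twT A Θ) (plT A p) (plT A q) c = twT A (corner A Θ p q c) := by
  fin_cases c <;> simp [corner, twT_flipAt]

omit [DecidableEq A] in
/-- Equal halves coordinatewise are preserved by the diagonal motions (`|B|` odd). [folklore] -/
theorem half_coord_twH₄_eq_iff (hA : Odd (Fintype.card A)) (g : ZMod 2 × A) (Θ Θ' : Ty₄ A) (n : Fin 4) :
    half A (coord A n (twH₄ A g Θ)) = half A (coord A n (twH₄ A g Θ')) ↔ half A (coord A n Θ) = half A (coord A n Θ') := by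
  rw [coord_twH₄, coord_twH₄, half_tw_eq_iff A hA]

omit [DecidableEq A] in
/-- Equal halves coordinatewise are preserved by the motion of `y` (`|B|` odd). [folklore] -/
theorem half_coord_twY_eq_iff (hA : Odd (Fintype.card A)) (ζ : ZMod 2) (Θ Θ' : Ty₄ A) (n : Fin 4) :
    half A (coord A n (twY A ζ Θ)) = half A (coord A n (twY A ζ Θ')) ↔ half A (coord A (σY n) Θ) = half A (coord A (σY n) Θ') := by
  obtain ⟨⟨ψ₀, ψ₁⟩, ⟨ψ₂, ψ₃⟩⟩ := Θ
  obtain ⟨⟨ψ₀', ψ₁'⟩, ⟨ψ₂', ψ₃'⟩⟩ := Θ'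
  fin_cases n <;> simp only [coord, twY, twX', σY, Matrix.cons_val_zero, Matrix.cons_val_one, Matrix.cons_val, Fin.zero_eta, Fin.mk_one,
    Fin.reduceFinMk, half_rev, half_add_cst_eq_iff A hA]

omit [AddCommGroup A] [DecidableEq A] in
/-- Equal halves coordinatewise are preserved by the motion of `t` (`|B|` odd). [folklore] -/
theorem half_coord_twT_eq_iff (hA : Odd (Fintype.card A)) (Θ Θ' : Ty₄ A) (n : Fin 4) :
    half A (coord A n (twT A Θ)) = half A (coord A n (twT A Θ')) ↔ half A (coord A (σT n) Θ) = half A (coord A (σT n) Θ') := by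
  obtain ⟨⟨ψ₀, ψ₁⟩, ⟨ψ₂, ψ₃⟩⟩ := Θ
  obtain ⟨⟨ψ₀', ψ₁'⟩, ⟨ψ₂', ψ₃'⟩⟩ := Θ'
  fin_cases n <;> simp only [coord, twT, σT, Matrix.cons_val_zero, Matrix.cons_val_one, Matrix.cons_val, Fin.zero_eta, Fin.mk_one,
    Fin.reduceFinMk, half_add_one_eq_iff A hA]

/-- **Reducing pairs move with the labels (`H₀`).** [folklore] -/
theorem reducing_twH₄ (hA : Odd (Fintype.card A)) (g : ZMod 2 × A) {Θ : Ty₄ A} {p q : Pl A}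
    (h : p ≠ q ∧ ∀ c, pot₄ A (corner A Θ p q c) < pot₄ A Θ ∧ ∀ n, half A (coord A n (corner A Θ p q c)) = half A (coord A n Θ)) :
    plH A g p ≠ plH A g q ∧ ∀ c, pot₄ A (corner A (twH₄ A g Θ) (plH A g p) (plH A g q) c) < pot₄ A (twH₄ A g Θ) ∧
      ∀ n, half A (coord A n (corner A (twH₄ A g Θ) (plH A g p) (plH A g q) c)) = half A (coord A n (twH₄ A g Θ)) := by
  refine ⟨fun e => h.1 (plH_injective A g e), fun c => ⟨?_, fun n => ?_⟩⟩
  · rw [corner_twH₄, pot₄_twH₄, pot₄_twH₄]; exact (h.2 c).1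
  · rw [corner_twH₄, half_coord_twH₄_eq_iff A hA]; exact (h.2 c).2 n

/-- **Reducing pairs move with the labels (`y`).** [folklore] -/
theorem reducing_twY (hA : Odd (Fintype.card A)) (ζ : ZMod 2) {Θ : Ty₄ A} {p q : Pl A}
    (h : p ≠ q ∧ ∀ c, pot₄ A (corner A Θ p q c) < pot₄ A Θ ∧ ∀ n, half A (coord A n (corner A Θ p q c)) = half A (coord A n Θ)) :
    plY A p ≠ plY A q ∧ ∀ c, pot₄ A (corner A (twY A ζ Θ) (plY A p) (plY A q) c) < pot₄ A (twY A ζ Θ) ∧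
      ∀ n, half A (coord A n (corner A (twY A ζ Θ) (plY A p) (plY A q) c)) = half A (coord A n (twY A ζ Θ)) := by
  refine ⟨fun e => h.1 (plY_injective A e), fun c => ⟨?_, fun n => ?_⟩⟩
  · rw [corner_twY, pot₄_twY, pot₄_twY]; exact (h.2 c).1
  · rw [corner_twY, half_coord_twY_eq_iff A hA]; exact (h.2 c).2 _

/-- **Reducing pairs move with the labels (`t`).** [folklore] -/
theorem reducing_twT (hA : Odd (Fintype.card A)) {Θ : Ty₄ A} {p q : Pl A}
    (h : p ≠ q ∧ ∀ c, pot₄ A (corner A Θ p q c) < pot₄ A Θ ∧ ∀ n, half A (coord A n (corner A Θ p q c)) = half A (coord A n Θ)) :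
    plT A p ≠ plT A q ∧ ∀ c, pot₄ A (corner A (twT A Θ) (plT A p) (plT A q) c) < pot₄ A (twT A Θ) ∧
      ∀ n, half A (coord A n (corner A (twT A Θ) (plT A p) (plT A q) c)) = half A (coord A n (twT A Θ)) := by
  refine ⟨fun e => h.1 (plT_injective A e), fun c => ⟨?_, fun n => ?_⟩⟩
  · rw [corner_twT, pot₄_twT, pot₄_twT]; exact (h.2 c).1
  · rw [corner_twT, half_coord_twT_eq_iff A hA]; exact (h.2 c).2 _

end Reducing

end

end Summit.HodgeConjecture.CorCM.Census.QuarticInversion
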